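import Mathlib
import HarnessLib
import Literature.MathematicalPhysics.QuantumFieldTheory.ConstructiveQFTWave0
import Summits.Ventures.LatticeQCDFlow.Exactness.InvolutiveMetropolis
import Summits.Ventures.LatticeQCDFlow.Exactness.MomentumRefresh
import Summits.Ventures.LatticeQCDFlow.Exactness.SplittingIntegrator
import Summits.Ventures.LatticeQCDFlow.Scaling.TopologicalCollar
import Summits.Ventures.LatticeQCDFlow.Scaling.FluxSectorCollar
import Summits.Ventures.LatticeQCDFlow.Scaling.FluxPatch
import Summits.Ventures.LatticeQCDFlow.Scaling.MDTunnellingLaw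
import Summits.Ventures.LatticeQCDFlow.Scaling.MDFluxTunnelling

/-!
# LatticeQCDFlow / Scaling — TUNNELLING LAWS IV(c): leapfrog HMC for compact `U(1)` is EXACT and obeys the flux tunnelling law

HONEST FRAMING: exact (Metropolis-corrected) sampling algorithms for lattice gauge theory;
figures of merit are autocorrelation/cost numbers at stated couplings and volumes; no
continuum-physics claim.

THEORY-2.md §3.3 / §5 (v4.3, theory seat GEN-24).  The engine's gauge HMC proposal is
`flip ∘ (leapfrog d g)^n` with `leapfrog d g = drift d * kick g * drift d`
(`Exactness/SplittingIntegrator.lean`: `kick g (q,p) = (q, p + g q)`, `drift d (q,p) = (d p q, p)`,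
`mulDrift e p = (e p * ·)`; exact for `e^{-H}(μ ⊗ ν)` by `gaugeLeapfrogHMC_isReversible`).  Here:
* §4 (generic phase space `Q × P`) the leapfrog trajectory as a NODE SEQUENCE: the period-three
  schedule `lfStep d g` (drift, kick, drift, …) has `⇑(leapfrog d g ^ n) = MD.nodes (lfStep d g) (3n)`
  (`coe_leapfrog_pow_eq_nodes`), and every step preserves `μ ⊗ ν` under the hypotheses of
  `SplittingIntegrator` (`measurePreserving_lfStep`).
* §5 (compact `U(1)` on `(ℤ/L)^d`, every `d`, `L ≥ 1`, plane `(μ,ν)` through `x₀`) with the half-step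
  exponential `halfExp δ p = (e ↦ exp(i (δ/2) p_e))`: the drift nodes are the drifts `drift (δ/2) p` of
  `Scaling/MDFluxTunnelling.lean` (`lfStep_halfExp_fst`, driving field `lfField k` = the momenta at
  the two drifts of each leapfrog step, `0` at the kick), so the `U(1)` HMC flux tunnelling law
  applies VERBATIM to the engine's kernel: **`u1_leapfrogHMC_topCharge_ne_le_sum`** — for every
  left-invariant s-finite `volU` (product Haar), translation-invariant s-finite `volP` (Lebesgue),
  measurable action `S`, kinetic term `T` with `0 < Z_T < ∞`, measurable force `g`, step size `δ`,
  trajectory length `n` and every `h : ℝ`,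
  `(e^{-S}volU ⊗ K){Q ≠ Q'} ≤ Z_T⁻¹ Σ_{k<3n} (e^{h}·B{z | z.1 ∈ driftCollar (δ/2) (lfField k z)} + B{ΔH_k > h})`;
  and the SAME kernel is EXACT (`u1_leapfrogHMC_exact`: `e^{-S}volU` is invariant for the
  configuration chain, by `Exactness/MomentumRefresh.hmc_config_exact` with the involution and volume
  hypotheses discharged by `SplittingIntegrator`; additionally `volP` negation-invariant).
  Exact AND, at stationarity, confined to its flux sector except through the momentum collar.
-/

noncomputable section

open MeasureTheory ProbabilityTheory Metric Set
open scoped ENNReal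
open Literature.MathematicalPhysics.QuantumFieldTheory Literature.MathematicalPhysics.QuantumLattice

namespace Summit.Ventures.LatticeQCDFlow.Theory2.Tunnelling.MD

/-! ## §4. The leapfrog trajectory as a node sequence -/

section Generic

variable {Q P : Type*} [AddCommGroup P]

/-- The period-three LEAPFROG SCHEDULE of `leapfrog d g = drift d * kick g * drift d`: as maps,
step `k` is the kick iff `k % 3 = 1`, else the drift. [folklore] -/
def lfStep (d : P → Equiv.Perm Q) (g : Q → P) (k : ℕ) : Q × P → Q × P :=
  if k % 3 = 1 then ⇑(Exactness.kick g) else ⇑(Exactness.drift d)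

/-- Three more nodes. [folklore] -/
theorem nodes_three_mul_succ {Z : Type*} (step : ℕ → Z → Z) (n : ℕ) :
    nodes step (3 * (n + 1)) =
      step (3 * n + 1 + 1) ∘ step (3 * n + 1) ∘ step (3 * n) ∘ nodes step (3 * n) := by
  have e : 3 * (n + 1) = 3 * n + 1 + 1 + 1 := by ring
  funext z
  rw [e]
  rfl

/-- **`n` leapfrog steps are `3n` nodes of the schedule.** [folklore] -/
theorem coe_leapfrog_pow_eq_nodes (d : P → Equiv.Perm Q) (g : Q → P) (n : ℕ) :
    ⇑(Exactness.leapfrog d g ^ n) = nodes (lfStep d g) (3 * n) := by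
  induction n with
  | zero => funext z; simp
  | succ n ih =>
      rw [pow_succ', Equiv.Perm.coe_mul, ih, nodes_three_mul_succ, Exactness.leapfrog,
        Equiv.Perm.coe_mul, Equiv.Perm.coe_mul]
      have h0 : ¬ (3 * n) % 3 = 1 := by omega
      have h1 : (3 * n + 1) % 3 = 1 := by omega
      have h2 : ¬ (3 * n + 1 + 1) % 3 = 1 := by omega
      simp only [lfStep, if_neg h0, if_pos h1, if_neg h2]
      rfl

/-- Every step of the schedule preserves `μ ⊗ ν` (drifts `μ`-preserving and jointly measurable,
`ν` translation-invariant, force measurable). [folklore] -/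
theorem measurePreserving_lfStep [MeasurableSpace Q] [MeasurableSpace P] [MeasurableAdd₂ P]
    {μ : Measure Q} {ν : Measure P} [SFinite μ] [SFinite ν] [ν.IsAddRightInvariant]
    {d : P → Equiv.Perm Q} {g : Q → P} (hdm : Measurable fun z : P × Q => d z.1 z.2)
    (hdp : ∀ p, MeasurePreserving (⇑(d p)) μ μ) (hg : Measurable g) (k : ℕ) :
    MeasurePreserving (lfStep d g k) (μ.prod ν) (μ.prod ν) := by
  unfold lfStep
  split_ifs
  · exact Exactness.measurePreserving_kick hg
  · exact Exactness.measurePreserving_drift hdm hdp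

/-- The configuration component of a schedule step with a group drift `mulDrift e`:
unchanged at the kick, left-multiplied by `e p` at the drifts. [folklore] -/
theorem lfStep_mulDrift_fst {G : Type*} [Group G] (e : P → G) (g : G → P) (k : ℕ) (z : G × P) :
    (lfStep (Exactness.mulDrift e) g k z).1 = if k % 3 = 1 then z.1 else e z.2 * z.1 := by
  unfold lfStep
  split_ifs <;> rfl

end Generic

end Summit.Ventures.LatticeQCDFlow.Theory2.Tunnelling.MD

namespace Summit.Ventures.LatticeQCDFlow.Theory2.Lattice.Flux

open Summit.Ventures.LatticeQCDFlow.Theory2.Tunnelling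

/-! ## §5. Compact `U(1)`: the engine's leapfrog HMC is exact and obeys the flux tunnelling law -/

variable {d L : ℕ}

/-- The half-step exponential of gauge-link leapfrog: `p ↦ (e ↦ exp(i (δ/2) p_e))`. [folklore] -/
def halfExp (δ : ℝ) (p : Edge d L → ℝ) : GaugeConfig d L Circle :=
  fun e => Circle.exp (δ / 2 * p e)

/-- The time-reversal law `e(−p) = e(p)⁻¹` of the half-step exponential. [folklore] -/
theorem halfExp_neg (δ : ℝ) (p : Edge d L → ℝ) : halfExp δ (-p) = (halfExp δ p)⁻¹ := by
  funext e
  simp [halfExp, mul_neg, Circle.exp_neg]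

/-- The driving field of node `k` of the leapfrog schedule: the momenta at the drifts, zero at the
kick. [folklore] -/
def lfField (k : ℕ) (z : GaugeConfig d L Circle × (Edge d L → ℝ)) : Edge d L → ℝ :=
  if k % 3 = 1 then 0 else z.2

/-- **The leapfrog drift nodes are the drifts of the flux law**: step `k` of the schedule moves the
configuration by `drift (δ/2) (lfField k z)`. [folklore] -/
theorem lfStep_halfExp_fst (δ : ℝ) (g : GaugeConfig d L Circle → (Edge d L → ℝ)) (k : ℕ)
    (z : GaugeConfig d L Circle × (Edge d L → ℝ)) :
    (MD.lfStep (Exactness.mulDrift (halfExp δ)) g k z).1 = drift (δ / 2) (lfField k z) z.1 := by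
  rw [MD.lfStep_mulDrift_fst]
  unfold lfField
  split_ifs
  · rw [drift_zero]
  · rfl

/-- The driving fields are measurable. [folklore] -/
theorem measurable_lfField (k : ℕ) : Measurable (lfField (d := d) (L := L) k) := by
  unfold lfField
  split_ifs
  · exact measurable_const
  · exact measurable_snd

variable [NeZero L]

/-- The half-step exponential is measurable (it is continuous). [folklore] -/
theorem measurable_halfExp (δ : ℝ) : Measurable (halfExp (d := d) (L := L) δ) := by
  refine Continuous.measurable (continuous_pi fun e => ?_)
  exact Circle.exp.continuous.comp (continuous_const.mul (continuous_apply e))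

/-- **THE ENGINE'S `U(1)` LEAPFROG HMC OBEYS THE FLUX TUNNELLING LAW.**  `volU` any left-invariant
s-finite measure on `U(1)^E`, `volP` any translation-invariant s-finite measure on `ℝ^E`, ANY
measurable action `S`, kinetic term `T` with `0 < Z_T < ∞`, ANY measurable force `g`, step size `δ`,
`n` leapfrog steps `drift(δ/2) ∘ kick ∘ drift(δ/2)`, momentum flip, Metropolis filter on `H = S + T`.
Per update at stationarity and for every `h : ℝ`:
`(e^{-S}volU ⊗ K){Q ≠ Q'} ≤ Z_T⁻¹ Σ_{k<3n} (e^{h}·B{z | z.1 ∈ driftCollar (δ/2) (lfField k z)} + B{ΔH_k > h})`,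
`B = e^{-(S+T)}(volU ⊗ volP)` — the kick terms (`k % 3 = 1`) are those of the zero field, i.e. of
"some plane plaquette is exactly `-1`". [folklore] -/
theorem u1_leapfrogHMC_topCharge_ne_le_sum (x₀ : Site d L) (μ ν : Fin d)
    (volU : Measure (GaugeConfig d L Circle)) [SFinite volU] [volU.IsMulLeftInvariant]
    (volP : Measure (Edge d L → ℝ)) [SFinite volP] [volP.IsAddRightInvariant]
    {S : GaugeConfig d L Circle → ℝ} (hS : Measurable S) {T : (Edge d L → ℝ) → ℝ} (hT : Measurable T)
    (δ : ℝ) {g : GaugeConfig d L Circle → (Edge d L → ℝ)} (hg : Measurable g) (n : ℕ)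
    (hZ0 : volP.withDensity (fun π => ENNReal.ofReal (Real.exp (-T π))) Set.univ ≠ 0)
    (hZtop : volP.withDensity (fun π => ENNReal.ofReal (Real.exp (-T π))) Set.univ ≠ ∞) (h : ℝ) :
    (MD.boltz volU S ⊗ₘ
        Exactness.refreshUpdate
          (Exactness.involMH
            (⇑((Exactness.flip : Equiv.Perm (GaugeConfig d L Circle × (Edge d L → ℝ))) *
              Exactness.leapfrog (Exactness.mulDrift (halfExp δ)) g ^ n))
            (Exactness.measurable_flip_leapfrog_pow
              (Exactness.measurable_mulDrift (measurable_halfExp δ)) hg n)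
            fun z : GaugeConfig d L Circle × (Edge d L → ℝ) => S z.1 + T z.2)
          ((volP.withDensity (fun π => ENNReal.ofReal (Real.exp (-T π))) Set.univ)⁻¹ •
            volP.withDensity fun π => ENNReal.ofReal (Real.exp (-T π))))
      {q | topCharge x₀ μ ν q.1 ≠ topCharge x₀ μ ν q.2} ≤
      (volP.withDensity (fun π => ENNReal.ofReal (Real.exp (-T π))) Set.univ)⁻¹ *
        ∑ k ∈ Finset.range (3 * n),
          (ENNReal.ofReal (Real.exp h) *
              MD.boltz (volU.prod volP) (fun z => S z.1 + T z.2)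
                {z | z.1 ∈ driftCollar x₀ μ ν (δ / 2) (lfField k z)} +
            MD.boltz (volU.prod volP) (fun z => S z.1 + T z.2)
              {z | h < (S (MD.nodes (MD.lfStep (Exactness.mulDrift (halfExp δ)) g) k z).1 +
                  T (MD.nodes (MD.lfStep (Exactness.mulDrift (halfExp δ)) g) k z).2) -
                (S z.1 + T z.2)}) :=
  hmc_topCharge_ne_le_sum x₀ μ ν volU volP hS hT
    (fun k => MD.measurePreserving_lfStep (Exactness.measurable_mulDrift (measurable_halfExp δ))
      (Exactness.measurePreserving_mulDrift (halfExp δ)) hg k)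
    (fun _ => δ / 2) (fun k => measurable_lfField k) (lfStep_halfExp_fst δ g)
    (flip := ⇑(Exactness.flip : Equiv.Perm (GaugeConfig d L Circle × (Edge d L → ℝ))))
    (fun _ => rfl) (3 * n) _
    (fun z => by rw [Equiv.Perm.coe_mul, MD.coe_leapfrog_pow_eq_nodes]; rfl) hZ0 hZtop h

/-- **… AND IT IS EXACT** (the tree's theorems assembled for the same kernel): with `volP` also
negation-invariant, the configuration chain — refresh `π ∼ Z_T⁻¹e^{-T}volP`, propose
`flip ∘ leapfrog^n`, Metropolis, forget `π` — leaves `e^{-S}volU` invariant, for every step size,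
trajectory length, measurable action and force. [folklore] -/
theorem u1_leapfrogHMC_exact (volU : Measure (GaugeConfig d L Circle)) [SFinite volU]
    [volU.IsMulLeftInvariant] (volP : Measure (Edge d L → ℝ)) [SFinite volP]
    [volP.IsAddRightInvariant] [volP.IsNegInvariant]
    {S : GaugeConfig d L Circle → ℝ} (hS : Measurable S) {T : (Edge d L → ℝ) → ℝ} (hT : Measurable T)
    (δ : ℝ) {g : GaugeConfig d L Circle → (Edge d L → ℝ)} (hg : Measurable g) (n : ℕ)
    (hZ0 : volP.withDensity (fun π => ENNReal.ofReal (Real.exp (-T π))) Set.univ ≠ 0)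
    (hZtop : volP.withDensity (fun π => ENNReal.ofReal (Real.exp (-T π))) Set.univ ≠ ∞) :
    Kernel.Invariant
      (Exactness.refreshUpdate
        (Exactness.involMH
          (⇑((Exactness.flip : Equiv.Perm (GaugeConfig d L Circle × (Edge d L → ℝ))) *
              Exactness.leapfrog (Exactness.mulDrift (halfExp δ)) g ^ n))
          (Exactness.measurable_flip_leapfrog_pow
            (Exactness.measurable_mulDrift (measurable_halfExp δ)) hg n)
          fun z : GaugeConfig d L Circle × (Edge d L → ℝ) => S z.1 + T z.2)
        ((volP.withDensity (fun π => ENNReal.ofReal (Real.exp (-T π))) Set.univ)⁻¹ •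
          volP.withDensity fun π => ENNReal.ofReal (Real.exp (-T π))))
      (MD.boltz volU S) :=
  Exactness.hmc_config_exact hS hT
    (Exactness.leapfrog_pow_isFlipReversible (Exactness.mulDrift_reversal (halfExp_neg δ)) g n).involutive
    (by
      rw [Equiv.Perm.coe_mul]
      exact Exactness.measurePreserving_flip.comp (Exactness.measurePreserving_perm_pow
        (Exactness.measurePreserving_leapfrog (Exactness.measurable_mulDrift (measurable_halfExp δ))
          (Exactness.measurePreserving_mulDrift (halfExp δ)) hg) n))
    hZ0 hZtop

end Summit.Ventures.LatticeQCDFlow.Theory2.Lattice.Flux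

end
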